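import Summits.BirchSwinnertonDyer.BirchSwinnertonDyer.Theorems.Rank1ResidualJetKolyvaginLocalTerm
import Summits.BirchSwinnertonDyer.BirchSwinnertonDyer.Theorems.GenusKolyvaginAtTwoEquivariantKolyvaginExactAtTwoLemma53Rat
import HarnessLib

/-!
# Route `GenusKolyvaginAtTwo`, crux L_T `PowDvdShaCardAtTwoRT` (stmt-BirchSwinnertonDyer-23242), LINE 18 stub KS, the DROPS, input `hrec` —
# THE REGULAR FRAME OF THE ADAPTED LIFT: at a deep inert Kolyvagin place on `Δ(E) < 0`, `τ̃_*` (`τ̃ = liftAutPlace τ hfix`) is a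
# REGULAR involution of `E[2^M](K̄)` — `E[2^M] = ℤQ₀ ⊕ ℤ·τ̃_*Q₀` freely over `ℤ/2^M` (hypotheses `hspan/hfree/htor` of `…RTLocalEigenDuality`)

Seat `bsd-line-gk2-p3` g23 (PROVER seat 3/3, cell `bsd-f1-sign2`), `--supports stmt-BirchSwinnertonDyer-23242` (helper; closes nothing).
THEOREMS ONLY (no definition, no named fact, no `sorry`).  BSD is NOT proved by any of this; neither is the crux nor any stub.

WHY.  The order law `…RTLocalEigenDuality.addOrderOf_invWeilPairing_unr_eq_of_same_sign` (the surviving terms of Kolyvagin's two-term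
reciprocity at `p = 2`; input `hrec` of `PlusDescent.weakSwapOracle_of_twoPrimeReciprocity`) asks that the parameter module
`T = E[2^M](K̄)` be FREE OF RANK ONE over `ℤ/2^M[t]` for the involution `t` transported from `σ_* = conjActPlace`; by
`…RTUnramifiedParametrization` that `t` is `τ̃_*` for the adapted lift `τ̃ = liftAutPlace τ hfix`.  THIS FILE proves the free structure
on `Δ(E) < 0`: the transport `γ ∈ Γ_ℚ` of `τ̃` (`liftAutPlace τ hfix x = e γ e⁻¹ x`, Jet `exists_transport_liftAutPlace_mem_decompositionSubgroup`)
lies in the decomposition group of `𝔓₀ ∩ \bar ℤ` (`𝔓₀` the prime of `\bar ℤ_K` cut out by `K̄ → \bar K_λ`); Gross's (3.2) at that prime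
(`FrobEqFrobInfty.exists_at`) gives a Frobenius `h` there acting on `E[2^M](ℚ̄)` as a complex conjugation `c₀`; `h⁻¹γ` fixes `K`
(both lift `τ`: `isLiftOfAut_absGaloisTransport_of_isArithFrobAt`) and stabilises `𝔓₀`, so it FIXES `E[2^M](K̄)` (Jet brick C
`smul_torsion_eq_self_of_mem_decompositionSubgroup`: the decomposition group of a Zhang–Kolyvagin prime of index `≥ M` fixes
`E[2^M]`); hence `τ̃_*` is `c₀` transported along `E[2^M](ℚ̄) ≃ E[2^M](K̄)` (`RatClosure.torsionEquiv`), and `c₀` is REGULAR on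
`Δ < 0` (route item Q1; LINE 6 `FrobeniusCriterion.exists_regular_generator_of_Δ_neg`: `E[2^M] = ℤP ⊕ ℤc₀P`).
* `torsionMap_liftAutPlace_eq_transport_conj` — `τ̃_* (e_K P) = e_K (c₀ • P)` for the data above;
* **`exists_regular_frame_liftAutPlace`** — `∃ Q₀`, `2^M Q₀ = 0`, `E[2^M](K̄) = {aQ₀ + b·τ̃_*Q₀}`,
  `aQ₀ + b·τ̃_*Q₀ = 0 ⟹ 2^M ∣ a, b`, and `τ̃_*² = 1` on `E[2^M](K̄)`.
Hypotheses: `K` imaginary quadratic, `τ ≠ 1`, `E/ℚ` globally minimal with `Δ < 0`, `ℓ` a Zhang–Kolyvagin prime at `2` with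
`M ≤ M(ℓ)` AND `FrobEqFrobInfty W K (2^M) ℓ` (the deep primes of LINE 18; on `Δ < 0` the latter follows from the former, gk2-p5 g22
`…RTGrossLevelAtTwo`), `λ ∋ ℓ`, `τ • λ = λ`, `1 ≤ M`.

References: [GrossLMS1991] §3 (3.1)–(3.4), §4; [Jetchev2008] §3.2 (2); [McCallumLMS1991] §5 Lemma 5.3; [Kolyvagin1991MathAnn] Thm. 2.1.
-/

set_option autoImplicit false

noncomputable section

open scoped Classical
open Function Field NumberField IsDedekindDomain WeierstrassCurve
open Literature.NumberTheory.EllipticCurves Literature.NumberTheory.GaloisRepresentations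
open Literature.NumberTheory.Automorphic
open Summit.BirchSwinnertonDyer.Rank1Residual.JET.GlobalDuality
open Summit.BirchSwinnertonDyer.BirchSwinnertonDyer.Theorems.GenusExact.FrobeniusCriterion

-- the Theorems namespace of this sub repeats the summit name by design (D-0017 nested layout)
set_option linter.dupNamespace false

namespace Summit.BirchSwinnertonDyer.BirchSwinnertonDyer.Theorems.GenusExact.PlusDescent

variable (W : WeierstrassCurve ℚ) (K : Type) [Field K] [NumberField K] [W.IsElliptic] [W.IsGloballyMinimal]

/-- **The adapted lift acts on `E[2^M](K̄)` as a complex conjugation transported from `E[2^M](ℚ̄)`.**  At a Zhang–Kolyvagin prime `ℓ` at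
`2` with `M ≤ M(ℓ)` and Gross's condition `FrobEqFrobInfty W K (2^M) ℓ`, `λ ∋ ℓ`, `τ ≠ 1`, `τ • λ = λ`: there is a complex conjugation
`c₀ ∈ Γ_ℚ` with `τ̃_* (e_K P) = e_K (c₀ • P)` for all `P ∈ E[2^M](ℚ̄)`, where `τ̃ = liftAutPlace τ hfix` and `e_K = RatClosure.torsionEquiv`.
[cite: GrossLMS1991, §3 (3.2)] [cite: Jetchev2008, §3.2 (2)] -/
theorem torsionMap_liftAutPlace_eq_transport_conj (hK : IsImaginaryQuadratic K) {M ℓ : ℕ}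
    (hℓ : Zhang2014.IsKolyvaginPrime (W.conductorNorm ℤ) W K 2 ℓ) (hk : M ≤ Zhang2014.kolyvaginIndex W 2 ℓ)
    (hF : FrobEqFrobInfty W K (2 ^ M) ℓ) (w : HeightOneSpectrum (𝓞 K)) (hw : (ℓ : 𝓞 K) ∈ w.asIdeal)
    {τ : K ≃ₐ[ℚ] K} (hτ1 : τ ≠ 1) (hfix : τ • w = w) :
    ∃ c₀ : absoluteGaloisGroup ℚ, IsComplexConjugation (Rat.castHom ℝ) c₀ ∧
      ∀ P : geomTorsion W ((2 ^ M : ℕ) : ℤ),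
        (isLiftOfAut_liftAutPlace τ hfix).torsionMap W ((2 ^ M : ℕ) : ℤ) (RatClosure.torsionEquiv (K := K) W ((2 ^ M : ℕ) : ℤ) P) =
          RatClosure.torsionEquiv (K := K) W ((2 ^ M : ℕ) : ℤ) (c₀ • P) := by
  haveI : Fact (Nat.Prime 2) := ⟨Nat.prime_two⟩
  have hℓp : ℓ.Prime := hℓ.1
  have hℓP : (Ideal.span {(ℓ : 𝓞 K)}).IsPrime := hℓ.2.2.2.2.1
  set n : ℤ := ((2 ^ M : ℕ) : ℤ) with hn
  -- the place `v₁` of `ℚ` below `w` and the prime `𝔓' = 𝔓₀ ∩ \bar ℤ`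
  set v₁ : HeightOneSpectrum (𝓞 ℚ) := w.under (𝓞 ℚ) with hv₁
  have hwv₁ : w.asIdeal.under (𝓞 ℚ) = v₁.asIdeal := rfl
  have hℓv₁ : (ℓ : 𝓞 ℚ) ∈ v₁.asIdeal := by
    rw [← hwv₁, Ideal.under_def, Ideal.mem_comap, map_natCast]; exact hw
  set 𝔓 := adicCompletionPrime K w with h𝔓def
  have h𝔓 : 𝔓 ∈ w.primesAbove := adicCompletionPrime_mem_primesAbove K w
  set 𝔓' := 𝔓.comap (absIntegersMap ℚ K) with h𝔓'def
  have h𝔓' : 𝔓' ∈ v₁.primesAbove := comap_absIntegersMap_mem_primesAbove hwv₁ h𝔓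
  haveI : 𝔓'.IsPrime := h𝔓'.1
  -- Gross's (3.2) at `𝔓'`: a Frobenius `h` there acting as a complex conjugation `c₀` on `E[2^M](ℚ̄)`
  obtain ⟨h, c₀, hFrob, hc₀, hhP, -⟩ := FrobEqFrobInfty.exists_at W hℓp hF hℓv₁ h𝔓'
  -- the transport `γ` of the adapted lift
  obtain ⟨γ, hγ, hγD⟩ := exists_transport_liftAutPlace_mem_decompositionSubgroup K τ hfix
  have ht := isLiftOfAut_liftAutPlace τ hfix
  -- `g₀ = h⁻¹ γ` fixes `K` and stabilises `𝔓₀`, hence fixes `E[2^M](K̄)`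
  have hlift : IsLiftOfAut τ (absGaloisTransport (K := ℚ) (L := K) h).toRingEquiv :=
    isLiftOfAut_absGaloisTransport_of_isArithFrobAt K hK hτ1 hℓp hℓP hw h𝔓 hℓv₁ h𝔓' hFrob
  set g₀ : absoluteGaloisGroup ℚ := h⁻¹ * γ with hg₀
  have hg₀K : g₀ ∈ Set.range (absGaloisRestrict ℚ K) := by
    rw [mem_range_absGaloisRestrict_iff]
    intro x
    rw [hg₀, map_mul, map_inv, AlgEquiv.mul_apply, ← hγ, ht x]
    have hx : absGaloisTransport (K := ℚ) (L := K) h (algebraMap K (AlgebraicClosure K) x) =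
        algebraMap K (AlgebraicClosure K) (τ x) := hlift x
    rw [← hx, ← AlgEquiv.mul_apply, inv_mul_cancel, AlgEquiv.one_apply]
  obtain ⟨g₁, hg₁⟩ := hg₀K
  have hg₁D : g₁ ∈ 𝔓.decompositionSubgroup (absoluteGaloisGroup K) := by
    rw [← comap_decompositionSubgroup_comap_absIntegersMap ℚ K 𝔓, Subgroup.mem_comap]
    change absGaloisRestrict ℚ K g₁ ∈ 𝔓'.decompositionSubgroup (absoluteGaloisGroup ℚ)
    rw [hg₁, hg₀]
    exact Subgroup.mul_mem _ (Subgroup.inv_mem _ hFrob.mem_stabilizer) hγD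
  have hg₀P : ∀ P : geomTorsion W n, g₀ • P = P := fun P => by
    apply (RatClosure.torsionEquiv (K := K) W n).injective
    rw [← hg₁, RatClosure.torsionEquiv_smul,
      smul_torsion_eq_self_of_mem_decompositionSubgroup W K hK hℓ hk w hw h𝔓 hg₁D]
  have hγP : ∀ P : geomTorsion W n, γ • P = c₀ • P := fun P => by
    have e : γ = h * g₀ := by rw [hg₀, mul_inv_cancel_left]
    rw [e, mul_smul, hg₀P, hhP]
  refine ⟨c₀, hc₀, fun P ↦ ?_⟩
  rw [← hγP, RatClosure.torsionEquiv_smul_of_lift W ht γ hγ n P]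

/-- **THE REGULAR FRAME OF THE ADAPTED LIFT on `Δ(E) < 0`** (hypotheses `hspan`, `hfree`, `htor` and the involutivity `ht` of
`…RTLocalEigenDuality` / `…RTInvariantLostBit` for `T = E[2^M](K̄)`, `t = τ̃_*`).  `K` imaginary quadratic, `τ ≠ 1`, `E/ℚ` globally
minimal with `Δ < 0`, `ℓ` a Zhang–Kolyvagin prime at `2` with `1 ≤ M ≤ M(ℓ)` and `FrobEqFrobInfty W K (2^M) ℓ`, `λ ∋ ℓ`, `τ • λ = λ`:
there is `Q₀ ∈ E[2^M](K̄)` with `2^M Q₀ = 0`, `E[2^M](K̄) = {aQ₀ + b·τ̃_*Q₀}`, `aQ₀ + b·τ̃_*Q₀ = 0 ⟹ 2^M ∣ a ∧ 2^M ∣ b`, and `τ̃_*` is an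
involution of `E[2^M](K̄)` — `E[2^M]` is free of rank one over `ℤ/2^M[τ̃_*]` (`τ̃_* = c₀` transported, `c₀` regular on `Δ < 0`).
[cite: GrossLMS1991, §4] [cite: McCallumLMS1991, §5 Lemma 5.3] [cite: Kolyvagin1991MathAnn, Thm. 2.1] -/
theorem exists_regular_frame_liftAutPlace (hK : IsImaginaryQuadratic K) (hΔ : W.Δ < 0) {M ℓ : ℕ} (hM : 1 ≤ M)
    (hℓ : Zhang2014.IsKolyvaginPrime (W.conductorNorm ℤ) W K 2 ℓ) (hk : M ≤ Zhang2014.kolyvaginIndex W 2 ℓ)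
    (hF : FrobEqFrobInfty W K (2 ^ M) ℓ) (w : HeightOneSpectrum (𝓞 K)) (hw : (ℓ : 𝓞 K) ∈ w.asIdeal)
    {τ : K ≃ₐ[ℚ] K} (hτ1 : τ ≠ 1) (hfix : τ • w = w) :
    ∃ Q₀ : geomTorsion (W.baseChange K) ((2 ^ M : ℕ) : ℤ),
      (2 ^ M : ℤ) • Q₀ = 0 ∧
      (∀ Q : geomTorsion (W.baseChange K) ((2 ^ M : ℕ) : ℤ), ∃ a b : ℤ,
        Q = a • Q₀ + b • (isLiftOfAut_liftAutPlace τ hfix).torsionMap W ((2 ^ M : ℕ) : ℤ) Q₀) ∧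
      (∀ a b : ℤ, a • Q₀ + b • (isLiftOfAut_liftAutPlace τ hfix).torsionMap W ((2 ^ M : ℕ) : ℤ) Q₀ = 0 →
        (2 ^ M : ℤ) ∣ a ∧ (2 ^ M : ℤ) ∣ b) ∧
      (∀ Q : geomTorsion (W.baseChange K) ((2 ^ M : ℕ) : ℤ),
        (isLiftOfAut_liftAutPlace τ hfix).torsionMap W ((2 ^ M : ℕ) : ℤ)
          ((isLiftOfAut_liftAutPlace τ hfix).torsionMap W ((2 ^ M : ℕ) : ℤ) Q) = Q) := by
  set n : ℤ := ((2 ^ M : ℕ) : ℤ) with hn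
  set t := (isLiftOfAut_liftAutPlace τ hfix).torsionMap W n with htdef
  set eK := RatClosure.torsionEquiv (K := K) W n with heK
  obtain ⟨c₀, hc₀, ht⟩ := torsionMap_liftAutPlace_eq_transport_conj W K hK hℓ hk hF w hw hτ1 hfix
  -- the regular generator of `E[2^M](ℚ̄)` for `c₀` on `Δ < 0`
  obtain ⟨P, hPtor, hgen, hfree⟩ := exists_regular_generator_of_Δ_neg W hΔ hc₀ hM
  have htP : t (eK P) = eK (c₀ • P) := ht P
  refine ⟨eK P, ?_, fun Q ↦ ?_, fun a b hab ↦ ?_, fun Q ↦ ?_⟩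
  · -- torsion
    rw [← map_zsmul, hPtor, map_zero]
  · -- generation, transported
    obtain ⟨a, b, hab⟩ := hgen (eK.symm Q)
    refine ⟨a, b, ?_⟩
    rw [htP, ← map_zsmul, ← map_zsmul, ← map_add, ← hab, AddEquiv.apply_symm_apply]
  · -- freeness, transported
    rw [htP, ← map_zsmul, ← map_zsmul, ← map_add, AddEquiv.map_eq_zero_iff] at hab
    exact hfree a b hab
  · -- involutivity: `τ̃_*² = c₀²` transported `= 1`
    obtain ⟨P', rfl⟩ := eK.surjective Q
    rw [ht P', ht (c₀ • P'), ← mul_smul, ← pow_two, hc₀.sq_eq_one, one_smul]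

end Summit.BirchSwinnertonDyer.BirchSwinnertonDyer.Theorems.GenusExact.PlusDescent

end
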